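import Summits.AtomisticToContinuum.Crystallization.Theorems.PerronTransitivityUniformBindingRigidityCohesionB
import Summits.AtomisticToContinuum.Crystallization.Theorems.PalmUnimodularRigidityUnimodularEnergyLowerBoundCluster

/-!
# Cohesion of uniformly bound Lennard-Jones configurations, V: no uniformly bound slabs

Helper file (`--supports stmt-AtomisticToContinuum-15099`) of the stub `stub_cohesion` of the line
`registered` (skeleton `Cruxes/UniformBindingRigidity/Lines/birth.lean`) of the crux
`Summit.AtomisticToContinuum.Crystallization.Theses.PerronTransitivity.UniformBindingRigidity`
(item stmt-AtomisticToContinuum-15099).  Part IV reduced the stub to `(NHB)`, the non-existence of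
uniformly `2e*`-bound separated half-space configurations.  This file and part VI prove the THIN
case of `(NHB)`: **no uniformly bound slab** — a `1/4`-separated `Y ∋ 0` contained in a slab
`{−T ≤ ⟪q, u⟫ ≤ 0}` has a site with Lennard-Jones site sum `> 2e*`.  Here the key inequality.

Mechanism (vertical doubling gains, lateral cutting costs little):
* §10 `slab_window_ineq` — for the lateral window `W_L = {q ∈ Y : ‖q − ⟪q,u⟫u‖ ≤ L}` apply the
  tree's finite-cluster inequality `Σ_{y,z ∈ F} V_LJ(‖z − y‖) ≥ 2·#F·e*` (periodisation,
  `UnimodularEnergy.two_mul_card_mul_eStar_le_sum_sum`) to the DOUBLED window `F = W_L ∪ (W_L + (T+2)u)`: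
  the cross terms are `≤ 0` (vertical offsets `≥ 2`) except the `#W_L` diagonal pairs at distance
  exactly `T + 2`, each `V_LJ(T+2) < 0`; so `Σ_{W_L × W_L} V ≥ 2·#W_L·e* + #W_L·|V_LJ(T+2)|`.  Uniform
  binding and the truncation inequality of part II bound the same sum from above by
  `2·#W_L·e* + Σ_{y ∈ W_L} tail(y)`, with `tail(y) ≤ 10923/D³` for `y` at lateral depth `≥ D` and
  `≤ 699051` always (`δ = 1/4`).  Hence
  `|V_LJ(T+2)|·#W_L ≤ (10923/D³)·#W_L + 699051·(#W_L − #W_{L−D})`.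
* part VI (`…CohesionF.lean`, `noSlabBinding`) — with `D³ ≥ 21846/|V_LJ(T+2)|` this reads
  `#W_{L−D} ≤ (1 − κ)·#W_L`, `κ > 0`, so `#W_{D+kD} ≥ (1−κ)^{-k}` grows exponentially in `k`,
  against the cubic packing bound `#W_L ≤ (8(L+T) + 1)³`.

The THICK case of `(NHB)` (points at all depths) is the open core.  All `[folklore]`.
-/

noncomputable section

namespace Summit.AtomisticToContinuum.Crystallization.Theorems.PerronTransitivityUniformBindingRigidity

open scoped BigOperators Topology
open Filter Set Metric
open Literature.MathematicalPhysics.StatisticalMechanics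
open Summit.AtomisticToContinuum.Crystallization.Theorems.ChargedEnergyGapNegative (E3 eStar)
open Summit.AtomisticToContinuum.Crystallization.Theorems.UnimodularEnergy
  (two_mul_card_mul_eStar_le_sum_sum)

/-! ## §10 Lateral projection, windows, and the window inequality -/

section Slab

variable {Y : Set E3} {u : E3} {T : ℝ}

/-- The lateral projection `q ↦ q − ⟪q, u⟫u` (`‖u‖ = 1`) is a contraction:
`‖v − ⟪v,u⟫u‖² = ‖v‖² − ⟪v,u⟫²`. [folklore] -/
theorem norm_lateral_sub_le (hu : ‖u‖ = 1) (a b : E3) :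
    ‖(a - inner ℝ a u • u) - (b - inner ℝ b u • u)‖ ≤ ‖a - b‖ := by
  have hv : (a - inner ℝ a u • u) - (b - inner ℝ b u • u) = (a - b) - inner ℝ (a - b) u • u := by
    rw [inner_sub_left, sub_smul]; abel
  rw [hv]
  set v := a - b with hvdef
  set c := inner ℝ v u with hc
  have hsq : ‖v - c • u‖ ^ 2 = ‖v‖ ^ 2 - c ^ 2 := by
    rw [norm_sub_sq_real, real_inner_smul_right, norm_smul, Real.norm_eq_abs, hu, mul_one, sq_abs,
      ← hc]
    ring
  have h2 : ‖v - c • u‖ ^ 2 ≤ ‖v‖ ^ 2 := by rw [hsq]; nlinarith [sq_nonneg c]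
  exact (pow_le_pow_iff_left₀ (norm_nonneg _) (norm_nonneg _) two_ne_zero).1 h2

/-- **The window inequality.** For a `1/4`-separated uniformly `2e*`-bound slab configuration
`Y ⊆ {−T ≤ ⟪·,u⟫ ≤ 0}` (`‖u‖ = 1`, `T ≥ 0`), its lateral windows `W_L ⊇ W_{L−D}` (`D ≥ 1/4`) satisfy
`|V_LJ(T+2)|·#W_L ≤ (10923/D³)·#W_L + 699051·(#W_L − #W_{L−D})` (doubling the window vertically
gains `|V_LJ(T+2)|` per site in the periodisation inequality; cutting it laterally costs the tails).
[folklore] -/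
theorem slab_window_ineq (hu : ‖u‖ = 1) (hT : 0 ≤ T)
    (hsep : ∀ p ∈ Y, ∀ q ∈ Y, p ≠ q → 1 / 4 ≤ dist p q)
    (hslab : ∀ q ∈ Y, -T ≤ inner ℝ q u ∧ inner ℝ q u ≤ 0)
    (hbd : ∀ p ∈ Y, ∑' q : {q : E3 // q ∈ Y ∧ q ≠ p}, lennardJones (dist p q.1) ≤ 2 * eStar)
    {L D : ℝ} (hD : 1 / 4 ≤ D) (W W' : Finset E3)
    (hW : ∀ q, q ∈ W ↔ q ∈ Y ∧ ‖q - inner ℝ q u • u‖ ≤ L)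
    (hW' : ∀ q, q ∈ W' ↔ q ∈ Y ∧ ‖q - inner ℝ q u • u‖ ≤ L - D) :
    -lennardJones (T + 2) * W.card ≤
      10923 / D ^ 3 * W.card + 699051 * ((W.card : ℝ) - W'.card) := by
  classical
  have h4 : (0 : ℝ) < 1 / 4 := by norm_num
  set c : E3 := (T + 2) • u with hc
  have hcn : ‖c‖ = T + 2 := by
    rw [hc, norm_smul, Real.norm_eq_abs, abs_of_nonneg (by linarith), hu, mul_one]
  have hcu : inner ℝ c u = T + 2 := by
    rw [hc, real_inner_smul_left, real_inner_self_eq_norm_sq, hu]; ring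
  -- the doubled window
  set τ : E3 → E3 := fun z => z + c with hτ
  have hτinj : Function.Injective τ := fun a b h => add_right_cancel h
  set B : Finset E3 := W.image τ with hB
  have hWY : ∀ q ∈ W, q ∈ Y := fun q hq => ((hW q).1 hq).1
  have hdisj : Disjoint W B := by
    rw [Finset.disjoint_left]
    intro q hqW hqB
    obtain ⟨z, hz, rfl⟩ := Finset.mem_image.1 hqB
    have h1 := (hslab _ (hWY _ hqW)).2
    have h2 := (hslab z (hWY z hz)).1
    have : inner ℝ (τ z) u = inner ℝ z u + (T + 2) := by
      show inner ℝ (z + c) u = _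
      rw [inner_add_left, hcu]
    linarith
  have hcard : ((W ∪ B).card : ℝ) = 2 * W.card := by
    rw [Finset.card_union_of_disjoint hdisj, hB, Finset.card_image_of_injective _ hτinj]
    push_cast; ring
  -- (a) the periodisation inequality on the doubled window
  have hclus := two_mul_card_mul_eStar_le_sum_sum (W ∪ B)
  rw [hcard] at hclus
  -- (b) expand the double sum over the disjoint union
  set f : E3 → E3 → ℝ := fun y z => lennardJones ‖z - y‖ with hf
  have hexp : ∑ y ∈ W ∪ B, ∑ z ∈ W ∪ B, f y z =
      (∑ y ∈ W, ∑ z ∈ W, f y z) + (∑ y ∈ W, ∑ z ∈ W, f y (τ z)) +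
        ((∑ y ∈ W, ∑ z ∈ W, f (τ y) z) + (∑ y ∈ W, ∑ z ∈ W, f (τ y) (τ z))) := by
    rw [Finset.sum_union hdisj]
    have hin : ∀ y, ∑ z ∈ W ∪ B, f y z = ∑ z ∈ W, f y z + ∑ z ∈ W, f y (τ z) := by
      intro y
      rw [Finset.sum_union hdisj, hB, Finset.sum_image fun a _ b _ h => hτinj h]
    simp only [hin, Finset.sum_add_distrib]
    rw [hB, Finset.sum_image fun a _ b _ h => hτinj h,
      Finset.sum_image fun a _ b _ h => hτinj h]
  -- the translated diagonal block equals the original one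
  have hBB : ∑ y ∈ W, ∑ z ∈ W, f (τ y) (τ z) = ∑ y ∈ W, ∑ z ∈ W, f y z := by
    refine Finset.sum_congr rfl fun y _ => Finset.sum_congr rfl fun z _ => ?_
    show lennardJones ‖(z + c) - (y + c)‖ = lennardJones ‖z - y‖
    rw [add_sub_add_right_eq_sub]
  -- vertical offsets: cross pairs are at distance `≥ 2`, the diagonal ones at distance `T + 2`
  have hvert : ∀ y ∈ W, ∀ z ∈ W, 2 ≤ ‖τ z - y‖ ∧ 2 ≤ ‖z - τ y‖ := by
    intro y hy z hz
    have hy' := hslab y (hWY y hy)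
    have hz' := hslab z (hWY z hz)
    constructor
    · have h1 : inner ℝ (τ z - y) u = inner ℝ z u + (T + 2) - inner ℝ y u := by
        show inner ℝ (z + c - y) u = _
        rw [inner_sub_left, inner_add_left, hcu]
      have h2 : inner ℝ (τ z - y) u ≤ ‖τ z - y‖ := by
        have := real_inner_le_norm (τ z - y) u
        rwa [hu, mul_one] at this
      linarith [hy'.2, hz'.1]
    · have h1 : inner ℝ (τ y - z) u = inner ℝ y u + (T + 2) - inner ℝ z u := by
        show inner ℝ (y + c - z) u = _
        rw [inner_sub_left, inner_add_left, hcu]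
      have h2 : inner ℝ (τ y - z) u ≤ ‖τ y - z‖ := by
        have := real_inner_le_norm (τ y - z) u
        rwa [hu, mul_one] at this
      rw [norm_sub_rev]
      linarith [hz'.2, hy'.1]
  have hVc : lennardJones (T + 2) < 0 := lennardJones_neg (by linarith)
  have hcross1 : ∑ y ∈ W, ∑ z ∈ W, f y (τ z) ≤ W.card * lennardJones (T + 2) := by
    have : ∀ y ∈ W, ∑ z ∈ W, f y (τ z) ≤ lennardJones (T + 2) := by
      intro y hy
      rw [← Finset.add_sum_erase W _ hy]
      have hdiag : f y (τ y) = lennardJones (T + 2) := by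
        show lennardJones ‖y + c - y‖ = _
        rw [add_sub_cancel_left, hcn]
      have hrest : ∑ z ∈ W.erase y, f y (τ z) ≤ 0 :=
        Finset.sum_nonpos fun z hz =>
          lennardJones_nonpos (by linarith [(hvert y hy z (Finset.mem_of_mem_erase hz)).1])
      linarith
    calc ∑ y ∈ W, ∑ z ∈ W, f y (τ z) ≤ ∑ _y ∈ W, lennardJones (T + 2) := Finset.sum_le_sum this
      _ = W.card * lennardJones (T + 2) := by rw [Finset.sum_const, nsmul_eq_mul]
  have hcross2 : ∑ y ∈ W, ∑ z ∈ W, f (τ y) z ≤ W.card * lennardJones (T + 2) := by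
    have : ∀ y ∈ W, ∑ z ∈ W, f (τ y) z ≤ lennardJones (T + 2) := by
      intro y hy
      rw [← Finset.add_sum_erase W _ hy]
      have hdiag : f (τ y) y = lennardJones (T + 2) := by
        show lennardJones ‖y - (y + c)‖ = _
        rw [sub_add_cancel_left, norm_neg, hcn]
      have hrest : ∑ z ∈ W.erase y, f (τ y) z ≤ 0 :=
        Finset.sum_nonpos fun z hz =>
          lennardJones_nonpos (by linarith [(hvert y hy z (Finset.mem_of_mem_erase hz)).2])
      linarith
    calc ∑ y ∈ W, ∑ z ∈ W, f (τ y) z ≤ ∑ _y ∈ W, lennardJones (T + 2) := Finset.sum_le_sum this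
      _ = W.card * lennardJones (T + 2) := by rw [Finset.sum_const, nsmul_eq_mul]
  -- (c) the self sum of the window, bounded from below
  have hself_lb : 2 * W.card * eStar - W.card * lennardJones (T + 2) ≤
      ∑ y ∈ W, ∑ z ∈ W, f y z := by
    have := hclus
    rw [hexp, hBB] at this
    linarith
  -- (d)–(f) ... and from above, by uniform binding and truncation
  have hself_ub : ∑ y ∈ W, ∑ z ∈ W, f y z ≤
      2 * W.card * eStar + 10923 / D ^ 3 * W.card + 699051 * ((W.card : ℝ) - W'.card) := by
    -- per-site bound
    have hsite : ∀ y ∈ W, ∑ z ∈ W, f y z ≤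
        2 * eStar + (if y ∈ W' then 10923 / D ^ 3 else 699051) := by
      intro y hy
      have hyY := hWY y hy
      -- drop the diagonal term (`V_LJ(0) = 0`) and pass to `dist`
      have hsum : ∑ z ∈ W, f y z = ∑ z ∈ W.erase y, lennardJones (dist y z) := by
        rw [← Finset.add_sum_erase W _ hy]
        have h0 : f y y = 0 := by show lennardJones ‖y - y‖ = 0; rw [sub_self, norm_zero, lennardJones_zero]
        rw [h0, zero_add]
        refine Finset.sum_congr rfl fun z _ => ?_
        show lennardJones ‖z - y‖ = lennardJones (dist y z)
        rw [dist_comm, dist_eq_norm]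
      rw [hsum]
      -- truncation radius
      set R : ℝ := max (L - ‖y - inner ℝ y u • u‖) (1 / 4) with hR
      have hR4 : 1 / 4 ≤ R := le_max_right _ _
      have htr := sum_le_tsum_add_of_far h4 hsep y hR4 (W.erase y)
        (fun b hb => ⟨hWY b (Finset.mem_of_mem_erase hb), (Finset.mem_erase.1 hb).1⟩)
        (by
          intro b hbY hby hbI
          have hbW : b ∉ W := fun h => hbI (Finset.mem_erase.2 ⟨hby, h⟩)
          rw [hW] at hbW
          have hlat : L < ‖b - inner ℝ b u • u‖ := by
            by_contra h
            exact hbW ⟨hbY, not_lt.1 h⟩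
          refine max_le ?_ (hsep b hbY y hyY hby)
          have h1 := norm_lateral_sub_le hu b y
          have h2 := norm_sub_norm_le (b - inner ℝ b u • u) (y - inner ℝ y u • u)
          rw [dist_eq_norm]
          linarith)
      have hUy := hbd y hyY
      have htail : 1 / 6 * (1024 / ((1 / 4 : ℝ) ^ 3 * R ^ 3)) ≤
          (if y ∈ W' then 10923 / D ^ 3 else 699051) := by
        have hR0 : 0 < R := by linarith
        split_ifs with hyW'
        · have hyL : ‖y - inner ℝ y u • u‖ ≤ L - D := ((hW' y).1 hyW').2
          have hRD : D ≤ R := le_trans (by linarith) (le_max_left _ _)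
          have hD0 : 0 < D := by linarith
          have hD3 : D ^ 3 ≤ R ^ 3 := pow_le_pow_left₀ hD0.le hRD 3
          rw [show 1 / 6 * (1024 / ((1 / 4 : ℝ) ^ 3 * R ^ 3)) = (32768 / 3) / R ^ 3 by
            field_simp; ring]
          rw [div_le_div_iff₀ (by positivity) (by positivity)]
          nlinarith [pow_pos hD0 3]
        · have hR3 : (1 / 4 : ℝ) ^ 3 ≤ R ^ 3 := pow_le_pow_left₀ (by norm_num) hR4 3
          rw [show 1 / 6 * (1024 / ((1 / 4 : ℝ) ^ 3 * R ^ 3)) = (32768 / 3) / R ^ 3 by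
            field_simp; ring]
          rw [div_le_iff₀ (by positivity)]
          nlinarith
      linarith
    -- sum the per-site bounds
    have hsplit : ∑ y ∈ W, (if y ∈ W' then (10923 / D ^ 3 : ℝ) else 699051) =
        10923 / D ^ 3 * W'.card + 699051 * ((W.card : ℝ) - W'.card) := by
      have hsub : W' ⊆ W := by
        intro q hq
        rw [hW'] at hq
        rw [hW]
        exact ⟨hq.1, hq.2.trans (by linarith)⟩
      rw [Finset.sum_ite, Finset.sum_const, Finset.sum_const, nsmul_eq_mul, nsmul_eq_mul]
      have h1 : (W.filter fun y => y ∈ W') = W' := by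
        ext q; simp only [Finset.mem_filter]; exact ⟨fun h => h.2, fun h => ⟨hsub h, h⟩⟩
      have h2 : ((W.filter fun y => ¬ y ∈ W').card : ℝ) = W.card - W'.card := by
        have := Finset.card_filter_add_card_filter_not (s := W) (fun y => y ∈ W')
        rw [h1] at this
        have h' : ((W'.card + (W.filter fun y => ¬ y ∈ W').card : ℕ) : ℝ) = W.card := by
          exact_mod_cast this
        push_cast at h'
        linarith
      rw [h1, h2]
      ring
    have hD3pos : 0 < D ^ 3 := by positivity
    calc ∑ y ∈ W, ∑ z ∈ W, f y z
        ≤ ∑ y ∈ W, (2 * eStar + (if y ∈ W' then 10923 / D ^ 3 else 699051)) :=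
          Finset.sum_le_sum hsite
      _ = 2 * W.card * eStar + (10923 / D ^ 3 * W'.card + 699051 * ((W.card : ℝ) - W'.card)) := by
          rw [Finset.sum_add_distrib, Finset.sum_const, nsmul_eq_mul, hsplit]; ring
      _ ≤ 2 * W.card * eStar + 10923 / D ^ 3 * W.card + 699051 * ((W.card : ℝ) - W'.card) := by
          have hsub : W'.card ≤ W.card := by
            refine Finset.card_le_card fun q hq => ?_
            rw [hW'] at hq; rw [hW]; exact ⟨hq.1, hq.2.trans (by linarith)⟩
          have : (W'.card : ℝ) ≤ W.card := by exact_mod_cast hsub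
          nlinarith [div_nonneg (by norm_num : (0:ℝ) ≤ 10923) hD3pos.le]
  linarith

/-! ## Registered sub-goal of `stub_cohesion`: the window inequality -/

/-- **Sub-goal `stub_cohesion_slabWindowIneq` of the stub `stub_cohesion`** (registered on
stmt-AtomisticToContinuum-15099): the window inequality `slab_window_ineq` in arrow form, with
`e* = ⨅_Q e(Q)` unfolded. [folklore] -/
theorem stub_cohesion_slabWindowIneq :
    ∀ (Y : Set (EuclideanSpace ℝ (Fin 3))) (u : EuclideanSpace ℝ (Fin 3)) (T L D : ℝ)
      (W W' : Finset (EuclideanSpace ℝ (Fin 3))), ‖u‖ = 1 → 0 ≤ T → 1 / 4 ≤ D →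
      (∀ p ∈ Y, ∀ q ∈ Y, p ≠ q → 1 / 4 ≤ dist p q) →
      (∀ q ∈ Y, -T ≤ inner ℝ q u ∧ inner ℝ q u ≤ 0) →
      (∀ p ∈ Y, ∑' q : {q : EuclideanSpace ℝ (Fin 3) // q ∈ Y ∧ q ≠ p},
          lennardJones (dist p q.1) ≤
        2 * ⨅ Q : PeriodicConfiguration 3, Q.energyPerParticle lennardJones) →
      (∀ q, q ∈ W ↔ q ∈ Y ∧ ‖q - inner ℝ q u • u‖ ≤ L) →
      (∀ q, q ∈ W' ↔ q ∈ Y ∧ ‖q - inner ℝ q u • u‖ ≤ L - D) →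
      -lennardJones (T + 2) * W.card ≤
        10923 / D ^ 3 * W.card + 699051 * ((W.card : ℝ) - W'.card) :=
  fun _ _ _ _ _ W W' hu hT hD hsep hslab hbd hW hW' =>
    slab_window_ineq hu hT hsep hslab hbd hD W W' hW hW'

end Slab

end Summit.AtomisticToContinuum.Crystallization.Theorems.PerronTransitivityUniformBindingRigidity

end
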